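import Summits.HubbardSuperconductivity.HubbardSuperconductivity.Theorems.AnisotropyChordTransferFibre3Symmetry
import Literature.MathematicalPhysics.QuantumLattice.RayleighBottom

/-!
# Route `AnisotropyChord` / H0 rotor rung: PORT N30-A proofs, part 2 — the variational principle on the symmetric
# hard-core sector and `CertLogic` from `KreinThree`

For the three-magnon `K`-fibre model of `…TransferFibre3` (theory seat `hubbard-h0-rotor-theory-1`, cycle 20, PORT SPEC
N30-A, memo ROTOR-THEORY-20 §278):

* `SectorMinAttained K Δ` (typed): if the symmetric hard-core `K` sector has an admissible function, the infimum of the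
  Rayleigh quotient `RQ K Δ` over admissible functions is attained at a sector (Dirichlet) eigenvalue;
* **`sectorMinAttained_holds`**: proof — minimise the quadratic form on the (compact) unit sphere of the symmetric
  Dirichlet subspace; the first-order condition (Hermiticity `ip_Happly_symm`) makes `(H − E)F₀` orthogonal to the subspace;
  since `H(Δ)` preserves the bosonic symmetry (`isSymm_Happly`) and the hard core is symmetric (`InD_swap`, `InD_U12`),
  the off-core restriction of `(H − E)F₀` lies in the subspace, hence vanishes: `F₀` is a Dirichlet eigenfunction;
* **`certLogic_of_kreinThree`**: `KreinThree L Δ → CertLogic L Δ` («min RQ is attained at a sector eigenvalue» + NOBIND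
  + `Φ(T) > T` on `(0, T*]` exclude every `K₁` level below `ε₁ + T*`).

Prover seat `hubbard-h0-rotor-p1` g21; helper for stmt-HubbardSuperconductivity-19089 (`--supports`).
-/

set_option linter.dupNamespace false
set_option autoImplicit false

noncomputable section

open scoped BigOperators
open Complex

namespace Summit.HubbardSuperconductivity.HubbardSuperconductivity.Theorems.AnisotropyChord.Transfer.Fibre3

variable (L : ℕ) [NeZero L]

/-! ## The typed variational principle and the certificate logic -/

/-- **MIN-ATTAINED** (variational principle on the symmetric hard-core `K` sector): whenever the sector has an admissible
function, the infimum of the Rayleigh quotient is attained at a sector (Dirichlet) eigenvalue.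
[conjecture: support statement of PORT SPEC N30-A (theory seat hubbard-h0-rotor-theory-1, cycle 20) — proved below,
`sectorMinAttained_holds`] -/
def SectorMinAttained (K : Tor L) (Δ : ℝ) : Prop :=
  ∀ F₁ : Cfg L → ℂ, Admissible L K F₁ →
    ∃ E : ℝ, IsSectorEigenvalue L K Δ E ∧ ∀ F : Cfg L → ℂ, Admissible L K F → E ≤ RQ L K Δ F

/-- **`CertLogic` from `KreinThree` and MIN-ATTAINED** (pure logic): the lowest `K₁` level is a sector eigenvalue `E`;
NOBIND gives `E > ε₁`; if `E ≤ ε₁ + T*` then `T₀ = E − ε₁ ∈ (0, T*]` would be a fixed point of `Φ` by `KreinThree`,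
contradicting `Φ(T₀) > T₀`; so every admissible `K₁` value is `≥ E > ε₁ + T* ≥ ε₁ + RQ₀(G)`. [folklore] -/
theorem certLogic_of_kreinThree_of_minAttained {Δ : ℝ} (hK : KreinThree L Δ)
    (hmin : SectorMinAttained L (K1 L) Δ) : CertLogic L Δ := by
  intro Tstar _ hT2 hNB hPhi hG F hF
  obtain ⟨G, hGadm, hGle⟩ := hG
  obtain ⟨E, hEeig, hEmin⟩ := hmin F hF
  have hE1 : eps1 L < E := hNB E hEeig
  have hT : Tstar < E - eps1 L := by
    by_contra h
    rw [not_lt] at h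
    have hT0' : 0 < E - eps1 L := by linarith
    have hlt2 : E - eps1 L < 2 * eps1 L := lt_of_le_of_lt h hT2
    have hfix : Phi L (E - eps1 L) Δ = E - eps1 L := by
      apply (hK (E - eps1 L) hT0' hlt2).1
      have e : eps1 L + (E - eps1 L) = E := by ring
      rw [e]; exact hEeig
    have := hPhi (E - eps1 L) hT0' h
    linarith
  refine ⟨G, hGadm, ?_⟩
  have := hEmin F hF
  linarith

/-! ## Sesquilinear bookkeeping -/

/-- `‖F‖² := Re⟨F, F⟩ = Σ_c ‖F c‖²`. [folklore] -/
theorem ip_self_re (F : Cfg L → ℂ) : (ip L F F).re = ∑ c : Cfg L, ‖F c‖ ^ 2 := by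
  unfold ip
  rw [Complex.re_sum]
  refine Finset.sum_congr rfl fun c _ => ?_
  rw [Complex.conj_mul']; norm_cast

/-- `Re⟨F,F⟩ ≥ 0`. [folklore] -/
theorem ip_self_nonneg (F : Cfg L → ℂ) : 0 ≤ (ip L F F).re := by
  rw [ip_self_re]; positivity

/-- `Re⟨F,F⟩ = 0 ⇒ F = 0`. [folklore] -/
theorem eq_zero_of_ip_self (F : Cfg L → ℂ) (h : (ip L F F).re = 0) : F = 0 := by
  rw [ip_self_re] at h
  have h' := (Finset.sum_eq_zero_iff_of_nonneg (fun c _ => sq_nonneg ‖F c‖)).1 h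
  funext c
  have := h' c (Finset.mem_univ c)
  have : ‖F c‖ = 0 := by
    rcases (sq_eq_zero_iff.mp this) with h0
    exact h0
  exact norm_eq_zero.mp this

/-- `⟨F, G + H⟩ = ⟨F, G⟩ + ⟨F, H⟩`. [folklore] -/
theorem ip_add_right (F G H : Cfg L → ℂ) : ip L F (G + H) = ip L F G + ip L F H := by
  unfold ip; rw [← Finset.sum_add_distrib]
  refine Finset.sum_congr rfl fun c _ => ?_
  rw [Pi.add_apply]; ring

/-- `⟨F + G, H⟩ = ⟨F, H⟩ + ⟨G, H⟩`. [folklore] -/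
theorem ip_add_left (F G H : Cfg L → ℂ) : ip L (F + G) H = ip L F H + ip L G H := by
  unfold ip; rw [← Finset.sum_add_distrib]
  refine Finset.sum_congr rfl fun c _ => ?_
  rw [Pi.add_apply, map_add]; ring

/-- `⟨F, a•G⟩ = a ⟨F, G⟩`. [folklore] -/
theorem ip_smul_right (a : ℂ) (F G : Cfg L → ℂ) : ip L F (a • G) = a * ip L F G := by
  unfold ip; rw [Finset.mul_sum]
  refine Finset.sum_congr rfl fun c _ => ?_
  rw [Pi.smul_apply, smul_eq_mul]; ring

/-- `⟨a•F, G⟩ = conj(a) ⟨F, G⟩`. [folklore] -/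
theorem ip_smul_left (a : ℂ) (F G : Cfg L → ℂ) : ip L (a • F) G = (starRingEnd ℂ) a * ip L F G := by
  unfold ip; rw [Finset.mul_sum]
  refine Finset.sum_congr rfl fun c _ => ?_
  rw [Pi.smul_apply, smul_eq_mul, map_mul]; ring

/-- the quadratic form `q(F) = Re⟨F, H F⟩`. [folklore] -/
def qform (K : Tor L) (Δ : ℝ) (F : Cfg L → ℂ) : ℝ := (ip L F (Happly L K Δ F)).re

/-- expansion of `q(F + t•G)` for real `t` (uses Hermiticity). [folklore] -/
theorem qform_add_smul (K : Tor L) (Δ : ℝ) (F G : Cfg L → ℂ) (t : ℝ) :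
    qform L K Δ (F + (t : ℂ) • G)
      = qform L K Δ F + 2 * t * (ip L G (Happly L K Δ F)).re + t ^ 2 * qform L K Δ G := by
  unfold qform
  rw [Happly_add, Happly_smul]
  simp only [ip_add_left, ip_add_right, ip_smul_left, ip_smul_right]
  have hs : ip L F (Happly L K Δ G) = (starRingEnd ℂ) (ip L G (Happly L K Δ F)) := ip_Happly_symm L K Δ F G
  rw [hs]
  simp only [Complex.add_re, Complex.mul_re, Complex.conj_re, Complex.ofReal_re, Complex.ofReal_im,
    Complex.conj_ofReal]
  ring

/-- expansion of `‖F + t•G‖²` for real `t`. [folklore] -/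
theorem ip_self_add_smul (F G : Cfg L → ℂ) (t : ℝ) :
    (ip L (F + (t : ℂ) • G) (F + (t : ℂ) • G)).re
      = (ip L F F).re + 2 * t * (ip L G F).re + t ^ 2 * (ip L G G).re := by
  simp only [ip_add_left, ip_add_right, ip_smul_left, ip_smul_right]
  have hs : ip L F G = (starRingEnd ℂ) (ip L G F) := (conj_ip L F G).symm
  rw [hs]
  simp only [Complex.add_re, Complex.mul_re, Complex.conj_re, Complex.ofReal_re, Complex.ofReal_im,
    Complex.conj_ofReal]
  ring

/-! ## The symmetric Dirichlet subspace -/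

/-- the symmetric hard-core subspace as a set: symmetric functions vanishing on the hard core. [folklore] -/
def symD (K : Tor L) : Set (Cfg L → ℂ) := {F | IsSymm L K F ∧ ∀ c, InD L c = true → F c = 0}

omit [NeZero L] in
/-- `symD` is closed under addition. [folklore] -/
theorem symD_add (K : Tor L) {F G : Cfg L → ℂ} (hF : F ∈ symD L K) (hG : G ∈ symD L K) : F + G ∈ symD L K := by
  obtain ⟨⟨hF1, hF2⟩, hFD⟩ := hF
  obtain ⟨⟨hG1, hG2⟩, hGD⟩ := hG
  refine ⟨⟨fun c => ?_, fun c => ?_⟩, fun c hc => ?_⟩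
  · simp only [Pi.add_apply, hF1 c, hG1 c]
  · simp only [Pi.add_apply, mul_add, hF2 c, hG2 c]
  · simp only [Pi.add_apply, hFD c hc, hGD c hc, add_zero]

omit [NeZero L] in
/-- `symD` is closed under complex scalars. [folklore] -/
theorem symD_smul (K : Tor L) (a : ℂ) {F : Cfg L → ℂ} (hF : F ∈ symD L K) : a • F ∈ symD L K := by
  obtain ⟨⟨hF1, hF2⟩, hFD⟩ := hF
  refine ⟨⟨fun c => ?_, fun c => ?_⟩, fun c hc => ?_⟩
  · simp only [Pi.smul_apply, smul_eq_mul, hF1 c]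
  · simp only [Pi.smul_apply, smul_eq_mul]; rw [← hF2 c]; ring
  · simp only [Pi.smul_apply, smul_eq_mul, hFD c hc, mul_zero]

/-- `H(Δ)F − E•F` inherits the symmetry. [folklore] -/
theorem isSymm_residual (K : Tor L) (Δ E : ℝ) {F : Cfg L → ℂ} (hF : IsSymm L K F) :
    IsSymm L K (fun c => Happly L K Δ F c - (E : ℂ) * F c) := by
  obtain ⟨h1, h2⟩ := isSymm_Happly L K Δ hF
  obtain ⟨hF1, hF2⟩ := hF
  refine ⟨fun c => ?_, fun c => ?_⟩
  · simp only [h1 c, hF1 c]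
  · show phase L K c.1 * (Happly L K Δ F (-c.1, c.2 - c.1) - (E : ℂ) * F (-c.1, c.2 - c.1))
        = Happly L K Δ F c - (E : ℂ) * F c
    rw [mul_sub, h2 c, ← hF2 c]; ring

omit [NeZero L] in
/-- the off-core restriction of a symmetric function lies in `symD`. [folklore] -/
theorem restrict_mem_symD (K : Tor L) {R : Cfg L → ℂ} (hR : IsSymm L K R) :
    (fun c => if InD L c = true then 0 else R c) ∈ symD L K := by
  obtain ⟨h1, h2⟩ := hR
  refine ⟨⟨fun c => ?_, fun c => ?_⟩, fun c hc => by simp [hc]⟩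
  · show (if InD L (c.2, c.1) = true then 0 else R (c.2, c.1)) = if InD L c = true then 0 else R c
    rw [InD_swap, h1 c]
  · show phase L K c.1 * (if InD L (-c.1, c.2 - c.1) = true then 0 else R (-c.1, c.2 - c.1))
        = if InD L c = true then 0 else R c
    rw [InD_U12]
    by_cases hc : InD L c = true
    · rw [if_pos hc, if_pos hc, mul_zero]
    · rw [if_neg hc, if_neg hc, h2 c]

/-! ## Continuity and compactness -/

omit [NeZero L] in
/-- evaluation of `Happly` at a configuration is continuous in `F`. [folklore] -/
theorem continuous_Happly_apply (K : Tor L) (Δ : ℝ) (c : Cfg L) :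
    Continuous fun F : Cfg L → ℂ => Happly L K Δ F c := by
  simp only [Happly_four, hopT]
  fun_prop

/-- `q` is continuous. [folklore] -/
theorem continuous_qform (K : Tor L) (Δ : ℝ) : Continuous (qform L K Δ) := by
  unfold qform ip
  refine Complex.continuous_re.comp ?_
  refine continuous_finsetSum _ fun c _ => ?_
  exact ((Complex.continuous_conj.comp (continuous_apply c)).mul (continuous_Happly_apply L K Δ c))

/-- `‖·‖²` is continuous. [folklore] -/
theorem continuous_ip_self : Continuous fun F : Cfg L → ℂ => (ip L F F).re := by
  unfold ip
  refine Complex.continuous_re.comp ?_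
  refine continuous_finsetSum _ fun c _ => ?_
  exact (Complex.continuous_conj.comp (continuous_apply c)).mul (continuous_apply c)

/-- the unit sphere of `symD` is compact. [folklore] -/
theorem isCompact_sphere_symD (K : Tor L) :
    IsCompact {F : Cfg L → ℂ | F ∈ symD L K ∧ (ip L F F).re = 1} := by
  apply Metric.isCompact_of_isClosed_isBounded
  · -- closed
    have hS : IsClosed (symD L K) := by
      have e : symD L K = (⋂ c : Cfg L, {F : Cfg L → ℂ | F (c.2, c.1) = F c})
          ∩ (⋂ c : Cfg L, {F : Cfg L → ℂ | phase L K c.1 * F (-c.1, c.2 - c.1) = F c})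
          ∩ (⋂ c : Cfg L, {F : Cfg L → ℂ | InD L c = true → F c = 0}) := by
        ext F
        simp only [symD, IsSymm, Set.mem_setOf_eq, Set.mem_inter_iff, Set.mem_iInter]
      rw [e]
      refine (IsClosed.inter (isClosed_iInter fun c => ?_) (isClosed_iInter fun c => ?_)).inter
        (isClosed_iInter fun c => ?_)
      · exact isClosed_eq (continuous_apply _) (continuous_apply _)
      · exact isClosed_eq ((continuous_const.mul (continuous_apply _))) (continuous_apply _)
      · by_cases hc : InD L c = true
        · have : {F : Cfg L → ℂ | InD L c = true → F c = 0} = {F | F c = 0} := by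
            ext F; simp [hc]
          rw [this]; exact isClosed_eq (continuous_apply _) continuous_const
        · have : {F : Cfg L → ℂ | InD L c = true → F c = 0} = Set.univ := by
            ext F; simp [hc]
          rw [this]; exact isClosed_univ
    exact hS.inter (isClosed_eq (continuous_ip_self L) continuous_const)
  · -- bounded: inside the closed unit ball of the sup norm
    refine (Metric.isBounded_closedBall (x := (0 : Cfg L → ℂ)) (r := 1)).subset fun F hF => ?_
    obtain ⟨_, hF1⟩ := hF
    rw [Metric.mem_closedBall, dist_zero_right, pi_norm_le_iff_of_nonneg zero_le_one]
    intro c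
    rw [ip_self_re] at hF1
    have hle : ‖F c‖ ^ 2 ≤ ∑ d : Cfg L, ‖F d‖ ^ 2 :=
      Finset.single_le_sum (fun d _ => sq_nonneg ‖F d‖) (Finset.mem_univ c)
    rw [hF1] at hle
    nlinarith [norm_nonneg (F c)]

/-! ## MIN-ATTAINED -/

/-- **The variational principle on the symmetric hard-core sector.** [folklore] -/
theorem sectorMinAttained_holds (K : Tor L) (Δ : ℝ) : SectorMinAttained L K Δ := by
  intro F₁ hF₁
  obtain ⟨hF₁s, hF₁D, hF₁ne⟩ := hF₁
  set S : Set (Cfg L → ℂ) := {F | F ∈ symD L K ∧ (ip L F F).re = 1} with hS_def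
  -- nonempty: normalise F₁
  have hn₁ : 0 < (ip L F₁ F₁).re := by
    rcases (ip_self_nonneg L F₁).lt_or_eq with h | h
    · exact h
    · exact absurd (eq_zero_of_ip_self L F₁ h.symm) hF₁ne
  have hSne : S.Nonempty := by
    refine ⟨((Real.sqrt ((ip L F₁ F₁).re))⁻¹ : ℂ) • F₁, symD_smul L K _ ⟨hF₁s, hF₁D⟩, ?_⟩
    rw [ip_smul_left, ip_smul_right, ← mul_assoc]
    have hr : 0 < Real.sqrt ((ip L F₁ F₁).re) := Real.sqrt_pos.mpr hn₁
    have : (starRingEnd ℂ) ((Real.sqrt ((ip L F₁ F₁).re))⁻¹ : ℂ) * ((Real.sqrt ((ip L F₁ F₁).re))⁻¹ : ℂ)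
        = (((ip L F₁ F₁).re)⁻¹ : ℝ) := by
      rw [← Complex.ofReal_inv, Complex.conj_ofReal, ← Complex.ofReal_mul, ← mul_inv, Real.mul_self_sqrt hn₁.le]
    rw [this, Complex.re_ofReal_mul, inv_mul_cancel₀ hn₁.ne']
  -- minimiser
  obtain ⟨F₀, hF₀S, hmin⟩ := (isCompact_sphere_symD L K).exists_isMinOn hSne (continuous_qform L K Δ).continuousOn
  obtain ⟨hF₀sym, hF₀1⟩ := hF₀S
  set E : ℝ := qform L K Δ F₀ with hE_def
  -- (1) E ≤ q(F)/‖F‖² on symD ∖ 0 (scaling)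
  have hscale : ∀ F : Cfg L → ℂ, F ∈ symD L K → E * (ip L F F).re ≤ qform L K Δ F := by
    intro F hF
    rcases (ip_self_nonneg L F).lt_or_eq with hpos | h0
    · set r : ℝ := Real.sqrt ((ip L F F).re) with hr_def
      have hr : 0 < r := Real.sqrt_pos.mpr hpos
      have hrr : r * r = (ip L F F).re := Real.mul_self_sqrt hpos.le
      have hmem : ((r⁻¹ : ℝ) : ℂ) • F ∈ S := by
        refine ⟨symD_smul L K _ hF, ?_⟩
        rw [ip_smul_left, ip_smul_right, ← mul_assoc, Complex.conj_ofReal, ← Complex.ofReal_mul, Complex.re_ofReal_mul,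
          ← hrr]
        field_simp
      have hq := hmin hmem
      rw [Set.mem_setOf_eq] at hq
      have hq' : qform L K Δ (((r⁻¹ : ℝ) : ℂ) • F) = r⁻¹ ^ 2 * qform L K Δ F := by
        unfold qform
        rw [Happly_smul, ip_smul_left, ip_smul_right, ← mul_assoc, Complex.conj_ofReal, ← Complex.ofReal_mul,
          Complex.re_ofReal_mul]
        ring
      rw [hq'] at hq
      rw [← hrr]
      have : E ≤ r⁻¹ ^ 2 * qform L K Δ F := hq
      have h3 : E * (r * r) ≤ r⁻¹ ^ 2 * qform L K Δ F * (r * r) := mul_le_mul_of_nonneg_right this (by positivity)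
      calc E * (r * r) ≤ r⁻¹ ^ 2 * qform L K Δ F * (r * r) := h3
        _ = qform L K Δ F := by field_simp
    · have hF0 : F = 0 := eq_zero_of_ip_self L F h0.symm
      subst hF0
      have : qform L K Δ (0 : Cfg L → ℂ) = 0 := by
        unfold qform ip; simp
      rw [this, ← h0]; simp
  -- (2) first-order condition: ⟨G, (H − E) F₀⟩ = 0 for G ∈ symD
  have hfirst : ∀ G : Cfg L → ℂ, G ∈ symD L K →
      (ip L G (Happly L K Δ F₀)).re - E * (ip L G F₀).re = 0 := by
    intro G hG
    have h2a : 2 * ((ip L G (Happly L K Δ F₀)).re - E * (ip L G F₀).re) = 0 := by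
      apply Literature.MathematicalPhysics.QuantumLattice.RayleighBottom.eq_zero_of_forall_quad_nonneg
        (b := qform L K Δ G - E * (ip L G G).re)
      intro t
      have hmem : F₀ + (t : ℂ) • G ∈ symD L K := symD_add L K hF₀sym (symD_smul L K _ hG)
      have h := hscale _ hmem
      rw [qform_add_smul, ip_self_add_smul, hF₀1] at h
      have hE : qform L K Δ F₀ = E := rfl
      rw [hE] at h
      have h' : E * (1 + 2 * t * (ip L G F₀).re + t ^ 2 * (ip L G G).re)
          = E + 2 * t * (E * (ip L G F₀).re) + t ^ 2 * (E * (ip L G G).re) := by ring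
      rw [h'] at h
      nlinarith [h]
    linarith
  have hortho : ∀ G : Cfg L → ℂ, G ∈ symD L K → ip L G (fun c => Happly L K Δ F₀ c - (E : ℂ) * F₀ c) = 0 := by
    intro G hG
    have hsplit : ip L G (fun c => Happly L K Δ F₀ c - (E : ℂ) * F₀ c) = ip L G (Happly L K Δ F₀) - (E : ℂ) * ip L G F₀ := by
      unfold ip; rw [Finset.mul_sum, ← Finset.sum_sub_distrib]
      refine Finset.sum_congr rfl fun c _ => ?_
      ring
    have hre := hfirst G hG
    have him := hfirst (Complex.I • G) (symD_smul L K _ hG)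
    rw [ip_smul_left, ip_smul_left, Complex.conj_I] at him
    simp only [neg_mul, Complex.neg_re, Complex.I_mul_re, neg_neg] at him
    apply Complex.ext
    · rw [hsplit, Complex.sub_re, Complex.re_ofReal_mul]; simpa using hre
    · rw [hsplit, Complex.sub_im, Complex.im_ofReal_mul]; simpa using him
  -- (3) the off-core residual vanishes
  set R : Cfg L → ℂ := fun c => Happly L K Δ F₀ c - (E : ℂ) * F₀ c with hR_def
  have hRsym : IsSymm L K R := isSymm_residual L K Δ E hF₀sym.1
  set R' : Cfg L → ℂ := fun c => if InD L c = true then 0 else R c with hR'_def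
  have hR'mem : R' ∈ symD L K := restrict_mem_symD L K hRsym
  have hzero := hortho R' hR'mem
  have hsum : (ip L R' R).re = ∑ c : Cfg L, (if InD L c = true then 0 else ‖R c‖ ^ 2) := by
    unfold ip; rw [Complex.re_sum]
    refine Finset.sum_congr rfl fun c _ => ?_
    simp only [hR'_def]
    split_ifs with hc
    · simp
    · rw [Complex.conj_mul']; norm_cast
  have hall : ∀ c : Cfg L, InD L c = false → R c = 0 := by
    intro c hc
    have h0 : (ip L R' R).re = 0 := by rw [hzero]; simp
    rw [hsum] at h0
    have := (Finset.sum_eq_zero_iff_of_nonneg (fun d _ => by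
      show (0 : ℝ) ≤ (if InD L d = true then 0 else ‖R d‖ ^ 2)
      split_ifs <;> positivity)).1 h0 c (Finset.mem_univ c)
    simp only [hc] at this
    have : ‖R c‖ = 0 := by
      have h' : ‖R c‖ ^ 2 = 0 := by simpa using this
      exact pow_eq_zero_iff (n := 2) (by norm_num) |>.mp h'
    exact norm_eq_zero.mp this
  -- (4) conclude
  have hF₀ne : F₀ ≠ 0 := by
    intro h; rw [h] at hF₀1; unfold ip at hF₀1; simp at hF₀1
  refine ⟨E, ⟨F₀, ⟨hF₀sym.1, hF₀sym.2, hF₀ne⟩, fun c hc => ?_⟩, fun F hF => ?_⟩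
  · have := hall c hc
    simp only [hR_def] at this
    exact sub_eq_zero.mp this
  · obtain ⟨hFs, hFD, hFne⟩ := hF
    have hpos : 0 < (ip L F F).re := by
      rcases (ip_self_nonneg L F).lt_or_eq with h | h
      · exact h
      · exact absurd (eq_zero_of_ip_self L F h.symm) hFne
    unfold RQ
    rw [le_div_iff₀ hpos]
    exact hscale F ⟨hFs, hFD⟩

/-- **`CertLogic` from `KreinThree`** (PORT SPEC N30-A, first theorem target, modulo the Krein identity). [folklore] -/
theorem certLogic_of_kreinThree {Δ : ℝ} (hK : KreinThree L Δ) : CertLogic L Δ :=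
  certLogic_of_kreinThree_of_minAttained L hK (sectorMinAttained_holds L (K1 L) Δ)

end Summit.HubbardSuperconductivity.HubbardSuperconductivity.Theorems.AnisotropyChord.Transfer.Fibre3

end
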